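import Summits.SmoothPoincare4.SmoothPoincare4.Theorems.CylinderEntropyCylinderRungTwoVerticalTestIdentity
import HarnessLib

/-!
# Route `CylinderEntropy`, crux `CylinderRungTwo` (stmt-SmoothPoincare4-7631), line `killing-flux`:
# the Killing identity `∫_M H ν₅ dμ_g = 0`
# (registered helper `helper_killingIdentity`, rigidity layer R1-B)

For a closed immersed cross-section `f : M⁴ → N = S⁴ × ℝ = {z ∈ ℝ⁶ | ∑_{i<5} zᵢ² = 1}` with smooth
unit normal `ν` tangent to `N` and mean curvature `H` (tree `meanCurvature` of `(f, ν)` in `ℝ⁶`),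

  `∫_M H ν₅ dμ_g = 0`,   `μ_g` the Riemannian measure of `g = f^*δ`.

This is the first variation of area along the PARALLEL vertical field `e₅` (a Killing field of `N`
tangent to `N`, whose tangential divergence vanishes), `0 = ∫_M div_M e₅ dμ_g = -∫_M H ⟨ν, e₅⟩ dμ_g`;
in particular a closed cross-section cannot be a translating soliton `H = c ν₅`, `c ≠ 0`, unless
`ν₅ ≡ 0`. We obtain it as the case `Ψ(s) = s` of the landed vertical test identity
`∫_M (Ψ''(z₅) (1 - ν₅²) - H Ψ'(z₅) ν₅) dμ_g = 0` (`verticalTest_identity`,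
`…VerticalTestIdentity.lean`): `Ψ' ≡ 1`, `Ψ'' ≡ 0`, so the integrand is `-(H ν₅)` pointwise and
`integral_neg` finishes.

* `killing_identity` — the identity, with implicit binders;
* `helper_killingIdentity` — the registered helper, verbatim.

Everything here is PROVED (no `sorry`, no new definitions, no named facts).

References: R. S. Hamilton, Comm. Anal. Geom. 1 (1993) 127–137, §4 (first variation on slices of
`S⁴ × ℝ`); L. Simon, *Lectures on Geometric Measure Theory* (1983), §16 (first variation,
`∫ div_M X = -∫ ⟨H⃗, X⟩`).
-/

-- the prescribed namespace `Summit.SmoothPoincare4.SmoothPoincare4.…` repeats `SmoothPoincare4`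
set_option linter.dupNamespace false

noncomputable section

open Bundle Set Function Filter MeasureTheory Module
open scoped Manifold ContDiff Topology RealInnerProductSpace BigOperators

namespace Summit.SmoothPoincare4.SmoothPoincare4.Cruxes.CylinderRungTwo.KillingFlux

open Literature.Geometry.Riemannian Literature.Geometry.Riemannian.EuclideanHypersurface
open Literature.Geometry.Lorentzian Literature.Geometry.Lorentzian.PseudoRiemannianMetric

/-! ## The Killing identity -/

section Identity

variable {M : Type*} [TopologicalSpace M] [ChartedSpace (EuclideanSpace ℝ (Fin 4)) M]
  [IsManifold (𝓡 4) ∞ M] [CompactSpace M] [T2Space M] [MeasurableSpace M] [BorelSpace M]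

/-- **The Killing identity** `∫_M H ν₅ dμ_g = 0` for a closed immersed cross-section
`f : M⁴ → N = S⁴ × ℝ ⊂ ℝ⁶` with smooth unit normal `ν` tangent to `N`, mean curvature `H` of
`(f, ν)` and `g = f^*δ`: the first variation of area along the parallel vertical field `e₅`,
i.e. the case `Ψ(s) = s` (`Ψ' ≡ 1`, `Ψ'' ≡ 0`) of the vertical test identity
`verticalTest_identity`. [cite: Hamilton1993, §4] -/
theorem killing_identity {f νf : M → EuclideanSpace ℝ (Fin 6)}
    (hf : (euclideanMetric (EuclideanSpace ℝ (Fin 6))).IsSpacelikeImmersion (𝓡 4) f)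
    (hν : ContMDiff (𝓡 4) 𝓘(ℝ, EuclideanSpace ℝ (Fin 6)) ∞ νf)
    (hun : (euclideanMetric (EuclideanSpace ℝ (Fin 6))).IsUnitNormal (𝓡 4) f νf 1)
    (hN : ∀ x, ∑ i : Fin 5, f x (Fin.castSucc i) ^ 2 = 1)
    (hνN : ∀ x, ∑ i : Fin 5, νf x (Fin.castSucc i) * f x (Fin.castSucc i) = 0) :
    ∫ w, (euclideanMetric (EuclideanSpace ℝ (Fin 6))).meanCurvature f contMDiff_pullbackBilin_holds
          hf νf w * νf w 5
      ∂riemannianMeasure ((euclideanMetric (EuclideanSpace ℝ (Fin 6))).inducedRiemannianMetric f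
        contMDiff_pullbackBilin_holds hf) = 0 := by
  -- the vertical test identity at `Ψ = id`: `Ψ' ≡ 1`, `Ψ'' ≡ 0`
  have h0 := verticalTest_identity hf hν hun hN hνN (Ψ := fun s : ℝ => s) contDiff_id
  simpa only [deriv_id'', deriv_const', zero_mul, one_mul, zero_sub, integral_neg,
    neg_eq_zero] using h0

end Identity

/-- **Registered helper `helper_killingIdentity` of line `killing-flux` (rigidity layer R1-B: the
first variation of area along the parallel vertical field `e₅`; it excludes closed translating
solitons).** For a closed immersed cross-section `f : M⁴ → N = S⁴ × ℝ` with smooth unit normal `ν`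
tangent to `N` and mean curvature `H` of `(f, ν)`: `∫_M H ν₅ dμ_g = 0`, `μ_g` the Riemannian
measure of `g = f^*δ` (`killing_identity`). [cite: Hamilton1993, §4] -/
theorem helper_killingIdentity :
    ∀ (M : Type) [TopologicalSpace M] [ChartedSpace (EuclideanSpace ℝ (Fin 4)) M] [IsManifold (𝓡 4) ∞ M] [CompactSpace M] [T2Space M] [MeasurableSpace M] [BorelSpace M] (f νf : M → EuclideanSpace ℝ (Fin 6)) (hf : (Literature.Geometry.Riemannian.euclideanMetric (EuclideanSpace ℝ (Fin 6))).IsSpacelikeImmersion (𝓡 4) f), ContMDiff (𝓡 4) (𝓡 6) ∞ νf → (Literature.Geometry.Riemannian.euclideanMetric (EuclideanSpace ℝ (Fin 6))).IsUnitNormal (𝓡 4) f νf 1 → (∀ x, ∑ i : Fin 5, f x (Fin.castSucc i) ^ 2 = 1) → (∀ x, ∑ i : Fin 5, νf x (Fin.castSucc i) * f x (Fin.castSucc i) = 0) → ∫ w, (Literature.Geometry.Riemannian.euclideanMetric (EuclideanSpace ℝ (Fin 6))).meanCurvature f Literature.Geometry.Lorentzian.PseudoRiemannianMetric.contMDiff_pullbackBilin_holds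 hf νf w * νf w 5 ∂Literature.Geometry.Lorentzian.riemannianMeasure ((Literature.Geometry.Riemannian.euclideanMetric (EuclideanSpace ℝ (Fin 6))).inducedRiemannianMetric f Literature.Geometry.Lorentzian.PseudoRiemannianMetric.contMDiff_pullbackBilin_holds hf) = 0 :=
  fun _ _ _ _ _ _ _ _ _ _ hf hν hun hN hνN =>
    killing_identity hf hν hun hN hνN

end Summit.SmoothPoincare4.SmoothPoincare4.Cruxes.CylinderRungTwo.KillingFlux

end
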